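import Mathlib.Analysis.Normed.Affine.AddTorsor
import Mathlib.Topology.Algebra.Affine
import Literature.Probability.LatticeModels.KilledWalkLaplacian
import Literature.Probability.Percolation.BoxCrossingProofs
import HarnessLib

/-!
# First exit of a segment from an open set; landing points of the non-kept lattice edges

Topic `Literature/Probability/LatticeModels`; setting of `DomainDiscretisation.lean` (mesh points
`meshPoint δ x`, mesh graph `meshGraph Ω δ` — nearest neighbours of `ℤ²` whose closed rescaled
segment lies in `Ω̄` —, discrete domain `meshDomain Ω δ` and its graph
`discreteDomainGraph Ω δ = Ω_δ`) and of `KilledWalkLaplacian.lean` (the simple random walk run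
along the edges of a subgraph `Gr` of `ℤ²` and killed at its first step that is not a `Gr`-edge;
neighbour average `killedAvg Gr`).

In Chelkak's formalism (Chelkak 2016, §2.2; Chelkak–Smirnov 2012, §1.2) a discrete domain comes
with its *boundary half-edges* `(a_int a)`: the lattice edges issuing from a vertex
`a_int ∈ Ω_δ` that are not edges of `Ω_δ`; the walk of `Ω_δ` is stopped when it first uses
such a half-edge, and `a` is the boundary point it carries. When `Ω_δ` discretises a planar
domain `Ω`, the point carried by a non-kept edge `[δy, δ(y+e)]` is the **first exit point** of
that segment from `Ω` — the *landing point* of the edge —, a genuine point of `∂Ω` within `δ`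
of `δy`. Contents (everything elementary, recorded as folklore; no random walk is used):

* `firstExitParam Ω p q ∈ [0, 1]`, `firstExitPoint Ω p q ∈ [p, q]`: the first parameter /
  point at which `t ↦ lineMap p q t = p + t (q - p)` leaves `Ω`. For `Ω` open, `p ∈ Ω` and
  `[p, q] ⊄ Ω` the parameter is positive, the point is off `Ω` and on `∂Ω`, and the segment
  before it lies in `Ω` (`firstExitParam_mem`, `firstExitPoint_mem_frontier`,
  `segment_firstExitPoint_diff_subset`; the existential form is
  `Literature.Probability.Percolation.exists_first_exit`, `Percolation/BoxCrossingUpperBound.lean`).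
* `edgeLanding Ω δ y e`, the landing point of the lattice edge `y → y + e` (`e : SRW.Dir 2`,
  `SRW.stepVec e ∈ {±e₀, ±e₁}`): on the segment, within `δ` of `δy`, and on `∂Ω` when the
  edge is not a mesh edge and `δy ∈ Ω` (`edgeLanding_mem_frontier`), in particular for every
  non-edge of `Ω_δ` at a vertex of `Ω_δ` (`edgeLanding_mem_frontier_of_not_adj`: such a
  non-edge is a non-kept mesh edge or leads off `Ω_δ`, `not_discreteDomainGraph_adj_iff`, and
  leaves `Ω` in both cases, `not_segment_subset_of_not_discreteDomainGraph_adj`).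
* The **landing classes** `landsIn Gr Ω δ A y e` (the edge `y → y + e` is not a `Gr`-edge and
  lands in `A ⊆ ℂ`) and the **side sources** `sideSrc Gr Ω δ A y = ¼ · #{e | landsIn … A y e}`,
  the one-step probability that the edge-killed walk at `y` dies through an edge landing in
  `A`: monotone and additive in `A`, `sideSrc_univ` (the one-step death rate), and
  `killedAvg Gr 1 y + sideSrc Gr Ω δ univ y = 1` (`killedAvg_one_add_sideSrc_univ`): the
  constant `1` solves the Poisson equation of the killed walk with source the death rate,
  which the landing classes split according to where the fatal edge lands.

Design. `firstExitParam Ω p q = sInf {t ∈ [0, 1] | lineMap p q t ∉ Ω}`; when the closed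
segment lies in `Ω` the set is empty and the junk value is `sInf ∅ = 0`, i.e.
`firstExitPoint Ω p q = p` (the frontier statements assume `[p, q] ⊄ Ω`). `sideSrc` uses
classical decidability, as `killedAvg` does.

## References

* D. Chelkak, *Robust discrete complex analysis: a toolbox*, Ann. Probab. 44 (2016), §2.2
  (discrete domains, interior and boundary vertices, boundary half-edges `(a_int a)`).
  [Chelkak2016]
* D. Chelkak, S. Smirnov, *Universality in the 2D Ising model and conformal invariance of
  fermionic observables*, Invent. Math. 189 (2012), §1.2 (discrete domains `Ω_δ` and their
  boundary). [ChelkakSmirnov2012]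
-/

noncomputable section

open scoped Classical Topology

namespace Literature.Probability.LatticeModels

open Set Filter AffineMap

/-! ### First exit of a segment from a set -/

section FirstExit

variable {Ω : Set ℂ} {p q : ℂ}

/-- The **first exit parameter** of the segment `[p, q]` from `Ω`: the infimum of the
parameters `t ∈ [0, 1]` with `lineMap p q t = p + t (q - p) ∉ Ω`. Junk value: if the closed
segment `[p, q]` lies in `Ω` the set is empty and `sInf ∅ = 0` in `ℝ`. [folklore] -/
def firstExitParam (Ω : Set ℂ) (p q : ℂ) : ℝ :=
  sInf {t : ℝ | t ∈ Icc (0 : ℝ) 1 ∧ lineMap p q t ∉ Ω}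

/-- The **first exit point** of the segment `[p, q]` from `Ω`: the point of parameter
`firstExitParam Ω p q` on the segment (junk value `p` when `[p, q] ⊆ Ω`). [folklore] -/
def firstExitPoint (Ω : Set ℂ) (p q : ℂ) : ℂ := lineMap p q (firstExitParam Ω p q)

/-- The set of exit parameters is bounded below by `0`. [folklore] -/
theorem bddBelow_exitParams : BddBelow {t : ℝ | t ∈ Icc (0 : ℝ) 1 ∧ lineMap p q t ∉ Ω} :=
  ⟨0, fun _ ht => ht.1.1⟩

/-- If the closed segment does not lie in `Ω`, some parameter in `[0, 1]` exits. [folklore] -/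
theorem exitParams_nonempty (hq : ¬ segment ℝ p q ⊆ Ω) :
    {t : ℝ | t ∈ Icc (0 : ℝ) 1 ∧ lineMap p q t ∉ Ω}.Nonempty := by
  obtain ⟨z, hz, hzΩ⟩ := not_subset.1 hq
  rw [segment_eq_image_lineMap ℝ p q] at hz
  obtain ⟨t, ht, rfl⟩ := hz
  exact ⟨t, ht, hzΩ⟩

/-- For open `Ω` the exit parameters form a closed set (`lineMap p q` is continuous). [folklore] -/
theorem isClosed_exitParams (hΩ : IsOpen Ω) :
    IsClosed {t : ℝ | t ∈ Icc (0 : ℝ) 1 ∧ lineMap p q t ∉ Ω} :=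
  isClosed_Icc.inter (hΩ.isClosed_compl.preimage (lineMap_continuous (p := p) (q := q)))

/-- The first exit parameter is nonnegative (also in the junk case). [folklore] -/
theorem firstExitParam_nonneg : 0 ≤ firstExitParam Ω p q :=
  Real.sInf_nonneg fun _ ht => ht.1.1

/-- The first exit parameter is at most `1` (also in the junk case). [folklore] -/
theorem firstExitParam_le_one : firstExitParam Ω p q ≤ 1 := by
  unfold firstExitParam
  rcases ({t : ℝ | t ∈ Icc (0 : ℝ) 1 ∧ lineMap p q t ∉ Ω}).eq_empty_or_nonempty with h | ⟨t, ht⟩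
  · rw [h, Real.sInf_empty]
    exact zero_le_one
  · exact (csInf_le bddBelow_exitParams ht).trans ht.1.2

/-- The first exit point lies on the closed segment `[p, q]`. [folklore] -/
theorem firstExitPoint_mem_segment : firstExitPoint Ω p q ∈ segment ℝ p q :=
  lineMap_mem_segment ℝ p q ⟨firstExitParam_nonneg, firstExitParam_le_one⟩

/-- The first exit point is at distance `firstExitParam Ω p q · |pq|` from `p`. [folklore] -/
theorem dist_firstExitPoint_eq :
    dist p (firstExitPoint Ω p q) = firstExitParam Ω p q * dist p q := by
  rw [firstExitPoint, dist_left_lineMap, Real.norm_eq_abs, abs_of_nonneg firstExitParam_nonneg]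

/-- The first exit point is no farther from `p` than `q`. [folklore] -/
theorem dist_firstExitPoint_le : dist p (firstExitPoint Ω p q) ≤ dist p q := by
  rw [dist_firstExitPoint_eq]
  exact mul_le_of_le_one_left dist_nonneg firstExitParam_le_one

/-- Before the first exit parameter the segment runs inside `Ω` (unconditional). [folklore] -/
theorem lineMap_mem_of_lt_firstExitParam {t : ℝ} (ht : t ∈ Ico 0 (firstExitParam Ω p q)) :
    lineMap p q t ∈ Ω := by
  by_contra h
  have hle : firstExitParam Ω p q ≤ t :=
    csInf_le bddBelow_exitParams ⟨⟨ht.1, ht.2.le.trans firstExitParam_le_one⟩, h⟩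
  exact absurd ht.2 (not_lt.2 hle)

/-- The closed segment from `p` to the first exit point, minus the exit point itself, lies in
`Ω` (unconditional: in the junk case the exit point is `p` and the set is empty). [folklore] -/
theorem segment_firstExitPoint_diff_subset :
    segment ℝ p (firstExitPoint Ω p q) \ {firstExitPoint Ω p q} ⊆ Ω := by
  rintro z ⟨hz, hzL⟩
  rw [segment_eq_image_lineMap ℝ] at hz
  obtain ⟨s, hs, rfl⟩ := hz
  rw [firstExitPoint, lineMap_lineMap_right, mem_singleton_iff] at hzL
  rw [firstExitPoint, lineMap_lineMap_right]
  have hs1 : s ≠ 1 := by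
    rintro rfl
    exact hzL (by rw [one_mul])
  refine lineMap_mem_of_lt_firstExitParam ⟨mul_nonneg hs.1 firstExitParam_nonneg, ?_⟩
  rcases firstExitParam_nonneg.eq_or_lt with h0 | h0
  · exact absurd (by rw [← h0, mul_zero]) hzL
  · exact mul_lt_of_lt_one_left h0 (lt_of_le_of_ne hs.2 hs1)

/-- If `Ω` is open and `[p, q] ⊄ Ω`, the first exit point is off `Ω`. [folklore] -/
theorem firstExitPoint_not_mem (hΩ : IsOpen Ω) (hq : ¬ segment ℝ p q ⊆ Ω) :
    firstExitPoint Ω p q ∉ Ω :=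
  ((isClosed_exitParams hΩ).csInf_mem (exitParams_nonempty hq) bddBelow_exitParams).2

/-- If moreover `p ∈ Ω`, the first exit parameter is positive. [folklore] -/
theorem firstExitParam_pos (hΩ : IsOpen Ω) (hp : p ∈ Ω) (hq : ¬ segment ℝ p q ⊆ Ω) :
    0 < firstExitParam Ω p q := by
  rcases firstExitParam_nonneg.eq_or_lt with h | h
  · have hL := firstExitPoint_not_mem hΩ hq
    rw [firstExitPoint, ← h, lineMap_apply_zero] at hL
    exact absurd hp hL
  · exact h

/-- **First exit.** For `Ω` open, `p ∈ Ω` and `[p, q] ⊄ Ω`: the first exit parameter lies in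
`(0, 1]` and the segment is off `Ω` there. [folklore] -/
theorem firstExitParam_mem (hΩ : IsOpen Ω) (hp : p ∈ Ω) (hq : ¬ segment ℝ p q ⊆ Ω) :
    firstExitParam Ω p q ∈ Ioc (0 : ℝ) 1 ∧ lineMap p q (firstExitParam Ω p q) ∉ Ω :=
  ⟨⟨firstExitParam_pos hΩ hp hq, firstExitParam_le_one⟩, firstExitPoint_not_mem hΩ hq⟩

/-- The first exit point of a segment issuing from `p ∈ Ω` lies in `Ω̄` (`p` itself, or a limit
of points `lineMap p q t ∈ Ω`, `t ↑ firstExitParam Ω p q`). [folklore] -/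
theorem firstExitPoint_mem_closure (hp : p ∈ Ω) : firstExitPoint Ω p q ∈ closure Ω := by
  rcases firstExitParam_nonneg.eq_or_lt with h0 | h0
  · rw [firstExitPoint, ← h0, lineMap_apply_zero]
    exact subset_closure hp
  · have hc : Continuous (lineMap p q : ℝ →ᵃ[ℝ] ℂ) := lineMap_continuous
    refine mem_closure_of_tendsto
      (hc.continuousAt.continuousWithinAt (s := Iio (firstExitParam Ω p q))).tendsto ?_
    filter_upwards [Ioo_mem_nhdsLT h0] with t ht
    exact lineMap_mem_of_lt_firstExitParam ⟨ht.1.le, ht.2⟩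

/-- **The first exit point is a boundary point.** For `Ω` open, `p ∈ Ω` and `[p, q] ⊄ Ω`,
`firstExitPoint Ω p q ∈ ∂Ω`. [folklore] -/
theorem firstExitPoint_mem_frontier (hΩ : IsOpen Ω) (hp : p ∈ Ω) (hq : ¬ segment ℝ p q ⊆ Ω) :
    firstExitPoint Ω p q ∈ frontier Ω := by
  rw [hΩ.frontier_eq]
  exact ⟨firstExitPoint_mem_closure hp, firstExitPoint_not_mem hΩ hq⟩

end FirstExit

/-! ### Landing points of lattice edges -/

section Landing

variable {Ω : Set ℂ} {δ : ℝ} {y : Site 2} {e : SRW.Dir 2}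

/-- The **landing point** of the lattice edge `y → y + e` of `δℤ²` with respect to `Ω`: the
first exit point of the closed segment `[δy, δ(y + e)]` from `Ω` (junk value `δy` when the
closed segment lies in `Ω`); for a boundary half-edge of `Ω_δ`, the point of `∂Ω` it carries.
[folklore] -/
def edgeLanding (Ω : Set ℂ) (δ : ℝ) (y : Site 2) (e : SRW.Dir 2) : ℂ :=
  firstExitPoint Ω (meshPoint δ y) (meshPoint δ (y + SRW.stepVec e))

/-- The two ends of a lattice edge of `δℤ²` are at distance `|δ|`. [folklore] -/
theorem dist_meshPoint_add_stepVec (δ : ℝ) (y : Site 2) (e : SRW.Dir 2) :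
    dist (meshPoint δ y) (meshPoint δ (y + SRW.stepVec e)) = |δ| :=
  Literature.Probability.Percolation.dist_meshPoint_of_adj (zdGraph_adj_add_stepVec y e)

/-- The landing point lies on the closed edge segment. [folklore] -/
theorem edgeLanding_mem_segment :
    edgeLanding Ω δ y e ∈ segment ℝ (meshPoint δ y) (meshPoint δ (y + SRW.stepVec e)) :=
  firstExitPoint_mem_segment

/-- The landing point is within `δ` of the starting vertex (`δ ≥ 0`). [folklore] -/
theorem dist_meshPoint_edgeLanding_le (hδ : 0 ≤ δ) :
    dist (meshPoint δ y) (edgeLanding Ω δ y e) ≤ δ :=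
  (dist_firstExitPoint_le).trans_eq ((dist_meshPoint_add_stepVec δ y e).trans (abs_of_nonneg hδ))

/-- The segment from `δy` to the landing point, minus the landing point, lies in `Ω`. [folklore] -/
theorem segment_edgeLanding_diff_subset :
    segment ℝ (meshPoint δ y) (edgeLanding Ω δ y e) \ {edgeLanding Ω δ y e} ⊆ Ω :=
  segment_firstExitPoint_diff_subset

/-- A lattice edge that is not a mesh edge leaves `Ω` (it even leaves `Ω̄`). [folklore] -/
theorem not_segment_subset_of_not_meshGraph_adj
    (h : ¬ (meshGraph Ω δ).Adj y (y + SRW.stepVec e)) :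
    ¬ segment ℝ (meshPoint δ y) (meshPoint δ (y + SRW.stepVec e)) ⊆ Ω := fun hseg =>
  h (meshGraph_adj_iff.2 ⟨zdGraph_adj_add_stepVec y e, hseg.trans subset_closure⟩)

/-- The landing point of a non-kept mesh edge of an open set is off `Ω`. [folklore] -/
theorem edgeLanding_not_mem (hΩ : IsOpen Ω) (h : ¬ (meshGraph Ω δ).Adj y (y + SRW.stepVec e)) :
    edgeLanding Ω δ y e ∉ Ω :=
  firstExitPoint_not_mem hΩ (not_segment_subset_of_not_meshGraph_adj h)

/-- **Non-kept mesh edges land on the boundary.** If `Ω` is open, `δy ∈ Ω` and the lattice edge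
`y → y + e` is not a mesh edge, its landing point lies on `∂Ω`. [folklore] -/
theorem edgeLanding_mem_frontier (hΩ : IsOpen Ω) (hy : meshPoint δ y ∈ Ω)
    (h : ¬ (meshGraph Ω δ).Adj y (y + SRW.stepVec e)) : edgeLanding Ω δ y e ∈ frontier Ω :=
  firstExitPoint_mem_frontier hΩ hy (not_segment_subset_of_not_meshGraph_adj h)

/-- A non-edge of `Ω_δ` at a vertex of `Ω_δ` is a non-kept mesh edge or leads off `Ω_δ`.
[folklore] -/
theorem not_discreteDomainGraph_adj_iff (hy : y ∈ meshDomain Ω δ) {z : Site 2} :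
    ¬ (discreteDomainGraph Ω δ).Adj y z ↔ ¬ (meshGraph Ω δ).Adj y z ∨ z ∉ meshDomain Ω δ := by
  rw [discreteDomainGraph_adj_iff]
  tauto

/-- A lattice edge at a vertex `y ∈ Ω_δ` that is not an edge of `Ω_δ` leaves `Ω`: else it is a
mesh edge whose far end is a mesh vertex, hence in `Ω_δ` (`mem_meshDomain_of_meshGraph_adj`).
[folklore] -/
theorem not_segment_subset_of_not_discreteDomainGraph_adj (hy : y ∈ meshDomain Ω δ) {z : Site 2}
    (hyz : (zdGraph 2).Adj y z) (h : ¬ (discreteDomainGraph Ω δ).Adj y z) :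
    ¬ segment ℝ (meshPoint δ y) (meshPoint δ z) ⊆ Ω := fun hseg =>
  have hadj : (meshGraph Ω δ).Adj y z := meshGraph_adj_iff.2 ⟨hyz, hseg.trans subset_closure⟩
  h (discreteDomainGraph_adj_iff.2 ⟨hadj, hy,
    Literature.Probability.Percolation.mem_meshDomain_of_meshGraph_adj hy
      (hseg (right_mem_segment ℝ _ _)) hadj⟩)

/-- **Non-edges of `Ω_δ` land on the boundary.** For `Ω` open and `y ∈ Ω_δ`, the landing point
of every lattice edge at `y` that is not an edge of `Ω_δ` lies on `∂Ω`. [folklore] -/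
theorem edgeLanding_mem_frontier_of_not_adj (hΩ : IsOpen Ω) (hy : y ∈ meshDomain Ω δ)
    (h : ¬ (discreteDomainGraph Ω δ).Adj y (y + SRW.stepVec e)) :
    edgeLanding Ω δ y e ∈ frontier Ω :=
  firstExitPoint_mem_frontier hΩ (meshDomain_subset_meshVertices Ω δ hy)
    (not_segment_subset_of_not_discreteDomainGraph_adj hy (zdGraph_adj_add_stepVec y e) h)

end Landing

/-! ### Landing classes and side sources of the edge-killed walk -/

section Sources

variable {Gr : SimpleGraph (Site 2)} {Ω : Set ℂ} {δ : ℝ} {A B : Set ℂ} {y : Site 2}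
  {e : SRW.Dir 2}

/-- The **landing class** of `A ⊆ ℂ`: the lattice edge `y → y + e` is *not* a `Gr`-edge (the
edge-killed walk dies along it) and its landing point with respect to `Ω` lies in `A`. [folklore] -/
def landsIn (Gr : SimpleGraph (Site 2)) (Ω : Set ℂ) (δ : ℝ) (A : Set ℂ) (y : Site 2)
    (e : SRW.Dir 2) : Prop :=
  ¬ Gr.Adj y (y + SRW.stepVec e) ∧ edgeLanding Ω δ y e ∈ A

/-- The **side source** of `A` at `y`: `¼ · #{e | landsIn Gr Ω δ A y e}`, the one-step
probability that the edge-killed walk at `y` dies through an edge landing in `A`. [folklore] -/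
def sideSrc (Gr : SimpleGraph (Site 2)) (Ω : Set ℂ) (δ : ℝ) (A : Set ℂ) (y : Site 2) : ℝ :=
  4⁻¹ * ((Finset.univ.filter fun e : SRW.Dir 2 => landsIn Gr Ω δ A y e).card : ℝ)

/-- Every non-`Gr`-edge lands in `univ`. [folklore] -/
@[simp] theorem landsIn_univ_iff : landsIn Gr Ω δ univ y e ↔ ¬ Gr.Adj y (y + SRW.stepVec e) := by
  simp [landsIn]

/-- Landing classes are monotone in the target set. [folklore] -/
theorem landsIn_mono (hAB : A ⊆ B) (h : landsIn Gr Ω δ A y e) : landsIn Gr Ω δ B y e :=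
  ⟨h.1, hAB h.2⟩

/-- Landing in a union. [folklore] -/
theorem landsIn_union_iff :
    landsIn Gr Ω δ (A ∪ B) y e ↔ landsIn Gr Ω δ A y e ∨ landsIn Gr Ω δ B y e := by
  simp only [landsIn, mem_union]
  tauto

/-- Side sources are nonnegative. [folklore] -/
theorem sideSrc_nonneg : 0 ≤ sideSrc Gr Ω δ A y := by
  unfold sideSrc
  positivity

/-- Side sources are at most `1` (at most four fatal edges). [folklore] -/
theorem sideSrc_le_one : sideSrc Gr Ω δ A y ≤ 1 := by
  unfold sideSrc
  have h := Finset.card_le_univ (Finset.univ.filter fun e : SRW.Dir 2 => landsIn Gr Ω δ A y e)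
  rw [SRW.card_dir] at h
  have h' : ((Finset.univ.filter fun e : SRW.Dir 2 => landsIn Gr Ω δ A y e).card : ℝ) ≤ 4 := by
    exact_mod_cast h
  linarith

/-- Side sources are monotone in the target set. [folklore] -/
theorem sideSrc_mono (hAB : A ⊆ B) : sideSrc Gr Ω δ A y ≤ sideSrc Gr Ω δ B y := by
  unfold sideSrc
  refine mul_le_mul_of_nonneg_left ?_ (by norm_num)
  exact_mod_cast
    Finset.card_le_card (Finset.monotone_filter_right _ fun e _ h => landsIn_mono hAB h)

/-- Side sources are additive over disjoint target sets. [folklore] -/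
theorem sideSrc_union_of_disjoint (hAB : Disjoint A B) :
    sideSrc Gr Ω δ (A ∪ B) y = sideSrc Gr Ω δ A y + sideSrc Gr Ω δ B y := by
  simp only [sideSrc, ← mul_add]
  congr 1
  have hfilter : (Finset.univ.filter fun e : SRW.Dir 2 => landsIn Gr Ω δ (A ∪ B) y e) =
      (Finset.univ.filter fun e : SRW.Dir 2 => landsIn Gr Ω δ A y e) ∪
        Finset.univ.filter fun e : SRW.Dir 2 => landsIn Gr Ω δ B y e := by
    rw [← Finset.filter_or]
    exact Finset.filter_congr fun e _ => landsIn_union_iff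
  have hdisj : Disjoint (Finset.univ.filter fun e : SRW.Dir 2 => landsIn Gr Ω δ A y e)
      (Finset.univ.filter fun e : SRW.Dir 2 => landsIn Gr Ω δ B y e) :=
    Finset.disjoint_filter.2 fun e _ hA hB => Set.disjoint_left.1 hAB hA.2 hB.2
  rw [hfilter, Finset.card_union_of_disjoint hdisj]
  push_cast
  ring

/-- **The total side source is the one-step death rate**:
`sideSrc Gr Ω δ univ y = ¼ · #{e | ¬ Gr.Adj y (y + e)}`. [folklore] -/
theorem sideSrc_univ : sideSrc Gr Ω δ univ y =
    4⁻¹ * ((Finset.univ.filter fun e : SRW.Dir 2 => ¬ Gr.Adj y (y + SRW.stepVec e)).card : ℝ) := by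
  simp only [sideSrc]
  congr 3
  exact Finset.filter_congr fun e _ => landsIn_univ_iff

/-- A side source is at most the one-step death rate. [folklore] -/
theorem sideSrc_le : sideSrc Gr Ω δ A y ≤
    4⁻¹ * ((Finset.univ.filter fun e : SRW.Dir 2 => ¬ Gr.Adj y (y + SRW.stepVec e)).card : ℝ) := by
  rw [← sideSrc_univ (Ω := Ω) (δ := δ)]
  exact sideSrc_mono (subset_univ A)

/-- Where all four lattice edges are `Gr`-edges there is no side source. [folklore] -/
theorem sideSrc_eq_zero_of_forall_adj (H : ∀ e : SRW.Dir 2, Gr.Adj y (y + SRW.stepVec e)) :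
    sideSrc Gr Ω δ A y = 0 := by
  have h : (Finset.univ.filter fun e : SRW.Dir 2 => landsIn Gr Ω δ A y e) = ∅ :=
    Finset.filter_eq_empty_iff.2 fun e _ he => he.1 (H e)
  simp [sideSrc, h]

/-- An edge of the landing class of `A` contributes `¼` to the side source. [folklore] -/
theorem inv_four_le_sideSrc_of_landsIn (h : landsIn Gr Ω δ A y e) : 4⁻¹ ≤ sideSrc Gr Ω δ A y := by
  unfold sideSrc
  have hcard : 1 ≤ (Finset.univ.filter fun e : SRW.Dir 2 => landsIn Gr Ω δ A y e).card :=
    Finset.card_pos.2 ⟨e, Finset.mem_filter.2 ⟨Finset.mem_univ e, h⟩⟩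
  have h' : (1 : ℝ) ≤ ((Finset.univ.filter fun e : SRW.Dir 2 => landsIn Gr Ω δ A y e).card : ℝ) :=
    by exact_mod_cast hcard
  linarith

variable (Gr)

/-- **Killed average plus killed mass.** For every `h`, the killed neighbour average plus `¼` of
the values of `h` across the non-`Gr`-edges is the plain lattice average. [folklore] -/
theorem killedAvg_add_sum_not_adj (h : Site 2 → ℝ) (y : Site 2) :
    killedAvg Gr h y +
        4⁻¹ * ∑ e ∈ Finset.univ.filter (fun e : SRW.Dir 2 => ¬ Gr.Adj y (y + SRW.stepVec e)),
          h (y + SRW.stepVec e) =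
      4⁻¹ * ∑ e : SRW.Dir 2, h (y + SRW.stepVec e) := by
  rw [killedAvg_def, Finset.sum_filter, ← mul_add, ← Finset.sum_add_distrib]
  congr 1
  refine Finset.sum_congr rfl fun e _ => ?_
  split_ifs <;> simp

/-- **The constant `1` solves the Poisson equation with source the death rate**:
`killedAvg Gr 1 y + sideSrc Gr Ω δ univ y = 1` at every site. [folklore] -/
theorem killedAvg_one_add_sideSrc_univ (y : Site 2) :
    killedAvg Gr 1 y + sideSrc Gr Ω δ univ y = 1 := by
  have h := killedAvg_add_sum_not_adj Gr 1 y
  simp only [Pi.one_apply, Finset.sum_const, nsmul_eq_mul, mul_one, Finset.card_univ,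
    SRW.card_dir] at h
  rw [sideSrc_univ, h]
  norm_num

end Sources

end Literature.Probability.LatticeModels
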